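import Summits.QuantumFields.BalabanUV.Beta.GAN24.SubAveragingMinimiserKernel
import Summits.QuantumFields.BalabanUV.Beta.GAN24.SubAveragingUnitTower

/-!
# `BalabanUV.Beta.GAN24.SubAveragingMinimiserUnitTower` — binder row G-an2-4 ∕ (CONV-C), programme «SUBAVG-H», FILE C:
# THE UNIT-READ COROLLARY IN (CONV-C)'s TWO-CLAUSE SHAPE FOR THE SCALAR HARD MINIMISER `H_k = 𝒢Q_k^*(Q_k𝒢Q_k^*)⁻¹` (B5 (1.103), massless,
# `U = 1`) — the block MEAN over the fine leg is a unit-lattice kernel with `j`-UNIFORM exponential decay AND the geometric one-step rate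
# `θ = L⁻²`, `n`-FREE constant, NO logarithm

NOT IN PRINT; OUR PROOF ATTEMPT (prover part P3 of row G-an2-4, fibre∕strip («Woodbury») lineage, gen 23; CRUX TEAM (2), ruling «YM
REDIRECT TOWARDS THE SUMMIT», 2026-08-21).  HONEST DEPENDENCY (cell records, verbatim): «continuum YM on T⁴ ⇐ BetaPertH ∧ nine spine
estimates (0/9 proved); BetaPertH ⇐ (D1) ∧ (D4) ∧ CAP+tail; G-an2-4 gates asym, D1 and NE2/3/4.»  HONEST FRAMING (cell contract,
verbatim): «discharging `BetaPertH` makes Bałaban's UV stability UNCONDITIONAL — a real constructive-QFT result; it is NOT the continuum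
limit and NOT the Clay problem.»  ABSOLUTE RULE: nothing printed is a hypothesis.  [folklore] assembly over FILES A∕B (`Hm`, `DmultH_eq`,
`stripRegular_DmultH`, `latticeKernel_DmultH`, `strip_data`, `minimiser_kernel_decay`), gen 22's `SubAveragingKernelL2` (the n-FREE block
pairing bound `norm_PhiD_le`, Parseval) and `SubAveragingUnitTower` (`sum_Tsub_eq`, `norm_mean_le`), `B4StripSums.norm_G_le`.  No
`def … : Prop`, no sorry; three [folklore] object∕constant definitions (`meanD`, `CU`, `KunitH`).

## Statement (`unitTowerH_two_clauses`)
`KunitH n x := (n^{d+1})⁻¹ Σ_{τ ∈ (Fin n)^{d+1}} latticeKernel (Hm n τ) x` — the MEAN over the `n^{d+1}` fine sites of a unit block of the kernel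
`(H_kB)`-column `H_k(y + τ∕n, y′)`, `x = y − y′ ∈ ℤ^{d+1}`, `n = L^k`.  For every `L ≥ 1` there are `κ > 0`, `C ≥ 0` (functions of `d`, `L`) with
 (i) `‖KunitH (L^j) x‖ ≤ C·e^{−κ|x|_∞}` for every `j`, `x` (uniform decay), and
 (ii) `‖KunitH (L^{j+1}) x − KunitH (L^j) x‖ ≤ C·(L²)^{−j}·e^{−κ|x|_∞}` for every `j`, `x` (geometric Cauchy, SHARP `θ = L⁻²`, NO logarithm)
— literally the two clauses of the cell's (CONV-C) shape for this unit-lattice-indexed constituent, on the INFINITE lattice.  Mechanism of (ii):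
the mean over `τ` of FILE A's splitting `DmultH = Dmult·(1+Leff′) + G·(Leff′ − Leff)` is the n-FREE multiplier `meanD` (§1: the `τ`-sum of
`Dmult` is gen 22's block pairing `PhiD` against the constant test vector, `‖·‖ ≤ n^{d+1}·48^{d+1}·Ccol∕n²` by Parseval; the `τ`-mean of `G` is
`≤ boundG`), strip regular with bound `CU∕n²` (§2), whose lattice kernel IS `KunitH(nL) − KunitH(n)` (§3, `sum_Tsub_eq`).

SPECIES ∕ DICTIONARY (so that nobody derives a cousin without saying which): the SCALAR hard minimiser column of B5 (1.103), massless, block-MEAN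
over the fine leg — the `a → ∞` sibling of gen 22's `SubAveragingUnitTower.Kunit` (B4 (2.48) soft column `G_jQ_j^*`; there `H = (G₁Q*)(1+Δ^{eff})`
is the bridge, FILE A); NOT road P2's `C^{(k)}(𝟙)`, NOT R0's `Q_k𝒢_kQ_k^*`, NOT the vector `H_k` of B5 (1.63).  CUSTOMERS (both PARKED under e34b3e0c):
asym1's `LimitForm.conv` constituent list and the NE2 sub-row; zero on the D1 grid.  NOT composites, NOT `U ≠ 1`.  NEVER «G-an2-4 closed»; NOT
D1, NOT BetaPertH, NOT continuum, NOT Clay.  Provenance: prover-b2b-balaban-gan24-p3-g23-0 (unit `b2b-balaban-gan24-p3`, gen 23), 2026-08-21.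
-/

noncomputable section

namespace Summit.QuantumFields.BalabanUV.Beta.GAN24.SubAveragingMinimiserUnitTower

open Complex Finset MeasureTheory
open scoped ComplexConjugate
open Literature.MathematicalPhysics.QuantumFieldTheory.Balaban1983to89
open Literature.MathematicalPhysics.QuantumFieldTheory.Balaban1983to89.B4Strip
open Literature.MathematicalPhysics.QuantumFieldTheory.Balaban1983to89.B4StripCauchy
open Literature.MathematicalPhysics.QuantumFieldTheory.Balaban1983to89.B4StripSums
open Literature.MathematicalPhysics.QuantumFieldTheory.Balaban1983to89.B4ContourShift
open Literature.MathematicalPhysics.QuantumFieldTheory.Balaban1983to89.B5Strip145Analytic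
open Summit.QuantumFields.BalabanUV.Beta.FP.ConstrainedBiLaplacianParseval (sqNorm sqNorm_nonneg)
open Summit.QuantumFields.BalabanUV.Beta.GAN24.SubAveragingFibreColumn
open Summit.QuantumFields.BalabanUV.Beta.GAN24.SubAveragingKernel
open Summit.QuantumFields.BalabanUV.Beta.GAN24.SubAveragingKernelL2
open Summit.QuantumFields.BalabanUV.Beta.GAN24.SubAveragingUnitTower (sum_Tsub_eq norm_mean_le)
open Summit.QuantumFields.BalabanUV.Beta.GAN24.SubAveragingMinimiser
open Summit.QuantumFields.BalabanUV.Beta.GAN24.SubAveragingMinimiserKernel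
open scoped Real

variable {d : ℕ}

/-! ## §1 The block-mean difference multiplier and its n-FREE bound -/

/-- [folklore] THE MEAN OVER THE COARSE FINE SITES OF A UNIT BLOCK of the hard difference multipliers: `meanD = (n^d)⁻¹ Σ_τ DmultH n L τ`. -/
def meanD (n L : ℕ) [NeZero n] [NeZero L] (p : Fin d → ℂ) : ℂ :=
  ((n : ℂ) ^ d)⁻¹ * ∑ τ : Fin d → Fin n, DmultH n L τ p

/-- [folklore] the `τ`-sum of gen 22's soft difference multipliers is the block pairing against the constant test vector `1`. -/
theorem sum_Dmult_eq_PhiD (n L : ℕ) [NeZero n] [NeZero L] (p : Fin d → ℂ) :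
    ∑ τ : Fin d → Fin n, Dmult n L 1 0 τ p = PhiD n L 1 0 (fun _ => (1 : ℂ)) p := by
  unfold PhiD
  simp only [map_one, one_mul]

/-- [folklore] the `τ`-sum of FILE A's splitting. -/
theorem sum_DmultH_eq (n L : ℕ) [NeZero n] [NeZero L] (p : Fin d → ℂ) :
    ∑ τ : Fin d → Fin n, DmultH n L τ p
      = (∑ τ : Fin d → Fin n, Dmult n L 1 0 τ p) * (1 + Leff (n * L) p)
        + (∑ τ : Fin d → Fin n, G n 1 0 τ p) * (Leff (n * L) p - Leff n p) := by
  simp_rw [DmultH_eq]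
  rw [Finset.sum_add_distrib, Finset.sum_mul, Finset.sum_mul]

/-- [folklore] `√(n^d·4^d·n^d)·√(576^d) = n^d·48^d`. -/
theorem sqrt_weights_eq (n d : ℕ) :
    Real.sqrt ((n : ℝ) ^ d * 4 ^ d * (n : ℝ) ^ d) * Real.sqrt ((576 : ℝ) ^ d) = (n : ℝ) ^ d * 48 ^ d := by
  have h4 : (4 : ℝ) ^ d = (2 ^ d) ^ 2 := by rw [← pow_mul, mul_comm, pow_mul]; norm_num
  have h576 : (576 : ℝ) ^ d = (24 ^ d) ^ 2 := by rw [← pow_mul, mul_comm, pow_mul]; norm_num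
  have e1 : (n : ℝ) ^ d * 4 ^ d * (n : ℝ) ^ d = ((n : ℝ) ^ d * 2 ^ d) ^ 2 := by rw [h4]; ring
  rw [e1, h576, Real.sqrt_sq (by positivity), Real.sqrt_sq (by positivity)]
  rw [show (48 : ℝ) ^ d = 2 ^ d * 24 ^ d by rw [← mul_pow]; norm_num]
  ring

/-- [folklore] **THE `τ`-SUM OF THE SOFT DIFFERENCES IS `O(n^d·n⁻²)` WITH AN n-FREE CONSTANT** (gen 22's Parseval pairing bound at `f ≡ 1`):
`‖Σ_τ Dmult n L 1 0 τ p‖ ≤ n^d·48^d·Ccol∕n²` on the fat region. -/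
theorem norm_sum_Dmult_le (n L : ℕ) [NeZero n] [NeZero L] {r : ℝ} (hr : r ≤ 1 / 4) (hdr : (d : ℝ) * r ^ 2 ≤ 1 / 16)
    {p : Fin d → ℂ} (hp : p ∈ Fat d r) {c : ℝ} (hc : 0 < c) (hcE : c ≤ ‖E n 1 0 p‖) (hcE' : c ≤ ‖E (n * L) 1 0 p‖) :
    ‖∑ τ : Fin d → Fin n, Dmult n L 1 0 τ p‖ ≤ (n : ℝ) ^ d * 48 ^ d * (Ccol d L 1 0 c / (n : ℝ) ^ 2) := by
  rw [sum_Dmult_eq_PhiD]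
  have h := norm_PhiD_le n L 1 0 zero_le_one le_rfl hr hdr hp hc hcE hcE' (fun _ => (1 : ℂ))
  have e : sqNorm (fun _ : Fin d → Fin n => (1 : ℂ)) = (n : ℝ) ^ d := by
    unfold sqNorm
    simp
  rw [e, sqrt_weights_eq] at h
  calc ‖PhiD n L 1 0 (fun _ => (1 : ℂ)) p‖ ≤ Ccol d L 1 0 c / (n : ℝ) ^ 2 * ((n : ℝ) ^ d * 48 ^ d) := h
    _ = (n : ℝ) ^ d * 48 ^ d * (Ccol d L 1 0 c / (n : ℝ) ^ 2) := by ring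

/-- [folklore] the `τ`-sum of the soft columns is `≤ n^d·boundG` (termwise `norm_G_le`). -/
theorem norm_sum_G_le (n : ℕ) [NeZero n] (hd : 0 < d) {r : ℝ} (hr : r ≤ 1 / 4) (hdr : (d : ℝ) * r ^ 2 ≤ 1 / 16)
    {p : Fin d → ℂ} (hp : p ∈ Fat d r) {c : ℝ} (hc : 0 < c) (hcE : c ≤ ‖E n 1 0 p‖) :
    ‖∑ τ : Fin d → Fin n, G n 1 0 τ p‖ ≤ (n : ℝ) ^ d * boundG d c 0 := by
  refine (norm_sum_le _ _).trans ?_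
  have h : ∀ τ ∈ (Finset.univ : Finset (Fin d → Fin n)), ‖G n 1 0 τ p‖ ≤ boundG d c 0 := fun τ _ =>
    norm_G_le n hd 1 0 0 le_rfl le_rfl hr hdr hp hc hcE τ
  refine (Finset.sum_le_sum h).trans ?_
  rw [Finset.sum_const, Finset.card_univ, Fintype.card_pi, Finset.prod_const, Fintype.card_fin, Finset.card_univ,
    Fintype.card_fin, nsmul_eq_mul]
  push_cast
  rfl

/-- [folklore] the n-FREE constant of the block-mean currency. -/
def CU (d L : ℕ) (c cF : ℝ) : ℝ := 48 ^ d * Ccol d L 1 0 c * (1 + 16 * (d : ℝ) / cF) + boundG d c 0 * CL d L cF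

/-- [folklore] `CU ≥ 0`. -/
theorem CU_nonneg (d L : ℕ) {c cF : ℝ} (hc : 0 < c) (hcF : 0 < cF) : 0 ≤ CU d L c cF := by
  have h2 := Ccol_nonneg d L (zero_le_one) (le_refl (0 : ℝ)) hc
  have h3 := boundG_nonneg d hc (le_refl (0 : ℝ))
  have h4 := CL_nonneg d L hcF
  unfold CU; positivity

/-- [folklore] **THE BLOCK-MEAN DIFFERENCE MULTIPLIER IS `O(n⁻²)` WITH AN n-FREE CONSTANT**: on the fat region (`0 < d`, `r ≤ 1∕4`, `d·r² ≤ 1∕16`),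
given the soft lower bounds `c` and the hard lower bounds `c_F` at the two levels, `‖meanD n L p‖ ≤ CU∕n²`. -/
theorem norm_meanD_le (n L : ℕ) [NeZero n] [NeZero L] (hd : 0 < d) {r : ℝ} (hr : r ≤ 1 / 4) (hdr : (d : ℝ) * r ^ 2 ≤ 1 / 16)
    {p : Fin d → ℂ} (hp : p ∈ Fat d r) {c cF : ℝ} (hc : 0 < c) (hcF : 0 < cF) (hcE : c ≤ ‖E n 1 0 p‖)
    (hcE' : c ≤ ‖E (n * L) 1 0 p‖) (hF : cF ≤ ‖E n 1 0 p - DeltaXi n 0 p‖)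
    (hF' : cF ≤ ‖E (n * L) 1 0 p - DeltaXi (n * L) 0 p‖) :
    ‖meanD n L p‖ ≤ CU d L c cF / (n : ℝ) ^ 2 := by
  have hn0 : (0 : ℝ) < n := by exact_mod_cast Nat.pos_of_ne_zero (NeZero.ne n)
  have hnd : (0 : ℝ) < (n : ℝ) ^ d := pow_pos hn0 d
  unfold meanD
  rw [sum_DmultH_eq, norm_mul, norm_inv, norm_pow, Complex.norm_natCast, inv_mul_le_iff₀ hnd]
  have h1 := norm_sum_Dmult_le n L hr hdr hp hc hcE hcE'
  have h2 := norm_one_add_Leff_le (n * L) hr hp hcF hF'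
  have h3 := norm_sum_G_le n hd hr hdr hp hc hcE
  have h4 := norm_Leff_sub_le n L hr hdr hp hcF hF hF'
  have hA : 0 ≤ (n : ℝ) ^ d * 48 ^ d * (Ccol d L 1 0 c / (n : ℝ) ^ 2) := by
    have := Ccol_nonneg d L zero_le_one le_rfl hc; positivity
  have hB : 0 ≤ (n : ℝ) ^ d * boundG d c 0 := mul_nonneg hnd.le (boundG_nonneg d hc le_rfl)
  calc ‖(∑ τ : Fin d → Fin n, Dmult n L 1 0 τ p) * (1 + Leff (n * L) p)
        + (∑ τ : Fin d → Fin n, G n 1 0 τ p) * (Leff (n * L) p - Leff n p)‖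
      ≤ ‖∑ τ : Fin d → Fin n, Dmult n L 1 0 τ p‖ * ‖1 + Leff (n * L) p‖
        + ‖∑ τ : Fin d → Fin n, G n 1 0 τ p‖ * ‖Leff (n * L) p - Leff n p‖ := by
        refine (norm_add_le _ _).trans ?_; rw [norm_mul, norm_mul]
    _ ≤ ((n : ℝ) ^ d * 48 ^ d * (Ccol d L 1 0 c / (n : ℝ) ^ 2)) * (1 + 16 * (d : ℝ) / cF)
        + ((n : ℝ) ^ d * boundG d c 0) * (CL d L cF / (n : ℝ) ^ 2) :=
        add_le_add (mul_le_mul h1 h2 (norm_nonneg _) hA) (mul_le_mul h3 h4 (norm_nonneg _) hB)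
    _ = (n : ℝ) ^ d * (CU d L c cF / (n : ℝ) ^ 2) := by unfold CU; field_simp

/-! ## §2 Strip regularity of the block-mean multiplier (with the n-free rate) and its kernel -/

/-- [folklore] **THE BLOCK-MEAN DIFFERENCE MULTIPLIER IS STRIP REGULAR WITH THE n-FREE RATE BOUND `CU∕n²`** (fields: scaled finite sum of FILE B's
`stripRegular_DmultH`; bound: `norm_meanD_le`). -/
theorem stripRegular_meanD (n L : ℕ) [NeZero n] [NeZero L] {κ c cF : ℝ} (hκ0 : 0 ≤ κ) (hκr : κ ≤ rOf (d + 1)) (hc : 0 < c)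
    (hcF : 0 < cF) (hE : ∀ p ∈ Strip (d + 1) κ, c ≤ ‖E n 1 0 p‖) (hE' : ∀ p ∈ Strip (d + 1) κ, c ≤ ‖E (n * L) 1 0 p‖)
    (hF : ∀ p ∈ Strip (d + 1) κ, cF ≤ ‖E n 1 0 p - DeltaXi n 0 p‖)
    (hF' : ∀ p ∈ Strip (d + 1) κ, cF ≤ ‖E (n * L) 1 0 p - DeltaXi (n * L) 0 p‖) :
    StripRegular (d := d) (meanD n L) κ (CU (d + 1) L c cF / (n : ℝ) ^ 2) := by
  have hsum := stripRegular_finsum (Finset.univ : Finset (Fin (d + 1) → Fin n)) (fun τ => DmultH n L τ)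
    (fun _ => CH n (d + 1) L c cF / (n : ℝ) ^ 2) (fun τ _ => stripRegular_DmultH n L τ hκ0 hκr hc hcF hE hE' hF hF')
  have h := (stripRegular_const (((n : ℂ) ^ (d + 1))⁻¹) κ).mul hsum (norm_nonneg _)
  have hr4 : rOf (d + 1) ≤ 1 / 4 := rOf_le (d + 1)
  have hdr : ((d + 1 : ℕ) : ℝ) * rOf (d + 1) ^ 2 ≤ 1 / 16 := by
    have h := d_mul_rOf_sq_le (d + 1)
    exact_mod_cast h
  have hd : 0 < d + 1 := Nat.succ_pos d
  refine ⟨h.cont, h.diff, h.sides, fun p hp => ?_⟩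
  have hpF : p ∈ Fat (d + 1) (rOf (d + 1)) := strip_subset_fat (le_of_lt (rOf_pos (d + 1))) hκr hp
  have h := norm_meanD_le n L hd hr4 (by exact_mod_cast hdr) hpF hc hcF (hE p hp) (hE' p hp) (hF p hp) (hF' p hp)
  exact_mod_cast h

/-- [folklore] the kernel of the block-mean multiplier is the block mean of the difference kernels (linearity of the Brillouin-zone integral). -/
theorem latticeKernel_meanD (n L : ℕ) [NeZero n] [NeZero L] {κ c cF : ℝ} (hκ0 : 0 ≤ κ) (hκr : κ ≤ rOf (d + 1)) (hc : 0 < c)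
    (hcF : 0 < cF) (hE : ∀ p ∈ Strip (d + 1) κ, c ≤ ‖E n 1 0 p‖) (hE' : ∀ p ∈ Strip (d + 1) κ, c ≤ ‖E (n * L) 1 0 p‖)
    (hF : ∀ p ∈ Strip (d + 1) κ, cF ≤ ‖E n 1 0 p - DeltaXi n 0 p‖)
    (hF' : ∀ p ∈ Strip (d + 1) κ, cF ≤ ‖E (n * L) 1 0 p - DeltaXi (n * L) 0 p‖) (x : Fin (d + 1) → ℤ) :
    latticeKernel (meanD n L) x = ((n : ℂ) ^ (d + 1))⁻¹ * ∑ τ : Fin (d + 1) → Fin n, latticeKernel (DmultH n L τ) x := by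
  have hint : ∀ τ : Fin (d + 1) → Fin n, IntegrableOn (integrand (DmultH n L τ) x) (BZ (d + 1)) := fun τ =>
    (stripRegular_DmultH n L τ hκ0 hκr hc hcF hE hE' hF hF').integrableOn hκ0 x
  unfold latticeKernel fourierBox
  have e : (fun q => integrand (meanD n L) x q)
      = fun q => ((n : ℂ) ^ (d + 1))⁻¹ * ∑ τ : Fin (d + 1) → Fin n, integrand (DmultH n L τ) x q := by
    funext q
    unfold integrand meanD
    rw [mul_assoc, Finset.sum_mul]
  rw [show (∫ q in BZ (d + 1), integrand (meanD n L) x q)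
      = ∫ q in BZ (d + 1), ((n : ℂ) ^ (d + 1))⁻¹ * ∑ τ : Fin (d + 1) → Fin n, integrand (DmultH n L τ) x q from by rw [e]]
  rw [integral_const_mul, integral_finsetSum _ (fun τ _ => hint τ)]
  simp only [Complex.real_smul]
  rw [Finset.mul_sum, Finset.mul_sum, Finset.mul_sum]
  exact Finset.sum_congr rfl fun τ _ => by ring

/-! ## §3 The unit-read kernel and THE TWO CLAUSES -/

/-- [folklore] THE UNIT-READ KERNEL of the hard minimiser: the mean over the `n^{d+1}` fine sites `τ` of a unit block of the kernel of the
column `H_k(· + τ∕n, ·)` at separation `x ∈ ℤ^{d+1}`. -/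
def KunitH (n : ℕ) [NeZero n] (x : Fin (d + 1) → ℤ) : ℂ :=
  (((n : ℂ) ^ (d + 1)))⁻¹ * ∑ τ : Fin (d + 1) → Fin n, latticeKernel (Hm n τ) x

/-- [folklore] **THE FINER BLOCK MEAN IS THE MEAN OF THE SUB-CELL AVERAGES**:
`KunitH (n·L) x = (n^{d+1})⁻¹ Σ_τ [(L^{d+1})⁻¹ Σ_ρ latticeKernel (Hm (n·L) (Tsub τ ρ)) x]`. -/
theorem KunitH_mul_eq (n L : ℕ) [NeZero n] [NeZero L] (x : Fin (d + 1) → ℤ) :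
    KunitH (n * L) x = (((n : ℂ) ^ (d + 1)))⁻¹ * ∑ τ : Fin (d + 1) → Fin n,
      ((((L : ℂ) ^ (d + 1)))⁻¹ * ∑ ρ : Fin (d + 1) → Fin L, latticeKernel (Hm (n * L) (Tsub n L τ ρ)) x) := by
  unfold KunitH
  rw [sum_Tsub_eq, ← Finset.mul_sum, ← mul_assoc]
  congr 1
  push_cast
  rw [mul_pow, mul_inv]

/-- [folklore] **THE ONE-STEP DIFFERENCE OF THE UNIT-READ KERNELS IS THE KERNEL OF THE BLOCK-MEAN MULTIPLIER**:
`KunitH (n·L) x − KunitH n x = latticeKernel (meanD n L) x`. -/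
theorem KunitH_sub_eq (n L : ℕ) [NeZero n] [NeZero L] {κ c cF : ℝ} (hκ0 : 0 ≤ κ) (hκr : κ ≤ rOf (d + 1)) (hc : 0 < c)
    (hcF : 0 < cF) (hE : ∀ p ∈ Strip (d + 1) κ, c ≤ ‖E n 1 0 p‖) (hE' : ∀ p ∈ Strip (d + 1) κ, c ≤ ‖E (n * L) 1 0 p‖)
    (hF : ∀ p ∈ Strip (d + 1) κ, cF ≤ ‖E n 1 0 p - DeltaXi n 0 p‖)
    (hF' : ∀ p ∈ Strip (d + 1) κ, cF ≤ ‖E (n * L) 1 0 p - DeltaXi (n * L) 0 p‖) (x : Fin (d + 1) → ℤ) :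
    KunitH (n * L) x - KunitH n x = latticeKernel (meanD n L) x := by
  rw [latticeKernel_meanD n L hκ0 hκr hc hcF hE hE' hF hF' x, KunitH_mul_eq]
  unfold KunitH
  rw [← mul_sub, ← Finset.sum_sub_distrib]
  congr 1
  exact Finset.sum_congr rfl fun τ _ => (latticeKernel_DmultH n L τ hκ0 hκr hc hcF hE hE' hF hF' x).symm

/-- [folklore] CLAUSE (i) at one level: the block mean inherits the uniform decay of `minimiser_kernel_decay`. -/
theorem norm_KunitH_le (n : ℕ) [NeZero n] {κ M : ℝ}
    (h : ∀ (τ : Fin (d + 1) → Fin n) (x : Fin (d + 1) → ℤ), ‖latticeKernel (Hm n τ) x‖ ≤ M * Real.exp (-(κ * supNorm x)))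
    (x : Fin (d + 1) → ℤ) : ‖KunitH n x‖ ≤ M * Real.exp (-(κ * supNorm x)) := by
  unfold KunitH
  have hcard : Fintype.card (Fin (d + 1) → Fin n) = n ^ (d + 1) := by
    rw [Fintype.card_pi, Finset.prod_const, Fintype.card_fin, Finset.card_univ, Fintype.card_fin]
  have hpos : 0 < n ^ (d + 1) := pow_pos (Nat.pos_of_ne_zero (NeZero.ne n)) _
  have e : (((n : ℂ) ^ (d + 1)))⁻¹ = (((n ^ (d + 1) : ℕ) : ℂ))⁻¹ := by push_cast; rfl
  rw [e]
  exact norm_mean_le (n ^ (d + 1)) hcard hpos _ fun τ => h τ x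

/-- [folklore] **THE UNIT-READ COROLLARY — (CONV-C)'s TWO CLAUSES for the block-mean kernels of the scalar hard minimiser `H_k` at `U = 1`.**
For every `L ≥ 1` there are `κ > 0` and `C ≥ 0` such that for every `j` and every `x ∈ ℤ^{d+1}`:
 (i) `‖KunitH (L^j) x‖ ≤ C·e^{−κ|x|_∞}`;  (ii) `‖KunitH (L^{j+1}) x − KunitH (L^j) x‖ ≤ C·((L²)⁻¹)^j·e^{−κ|x|_∞}`
— `j`-uniform exponential decay AND the geometric one-step rate at the SHARP exponent `θ = L⁻²`, NO logarithm, on the INFINITE lattice. -/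
theorem unitTowerH_two_clauses (d : ℕ) (L : ℕ) [NeZero L] :
    ∃ κ C : ℝ, 0 < κ ∧ 0 ≤ C ∧
      (∀ (j : ℕ) (x : Fin (d + 1) → ℤ),
        ‖@KunitH d (L ^ j) ⟨pow_ne_zero j (NeZero.ne L)⟩ x‖ ≤ C * Real.exp (-(κ * supNorm x))) ∧
      (∀ (j : ℕ) (x : Fin (d + 1) → ℤ),
        ‖@KunitH d (L ^ (j + 1)) ⟨pow_ne_zero (j + 1) (NeZero.ne L)⟩ x - @KunitH d (L ^ j) ⟨pow_ne_zero j (NeZero.ne L)⟩ x‖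
          ≤ C * (((L : ℝ) ^ 2)⁻¹) ^ j * Real.exp (-(κ * supNorm x))) := by
  obtain ⟨κ₁, M, hκ₁, hM, h1⟩ := minimiser_kernel_decay d
  obtain ⟨κ₂, c, cF, hκ₂, hκr, hc, hcF, h2⟩ := strip_data (d + 1)
  set C₂ : ℝ := CU (d + 1) L c cF with hC₂
  have hC₂0 : 0 ≤ C₂ := CU_nonneg (d + 1) L hc hcF
  refine ⟨min κ₁ κ₂, max M C₂, lt_min hκ₁ hκ₂, le_max_of_le_left hM, ?_, ?_⟩
  · intro j x
    haveI : NeZero (L ^ j) := ⟨pow_ne_zero j (NeZero.ne L)⟩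
    have h := norm_KunitH_le (L ^ j) (fun τ x => h1 (L ^ j) τ x) x
    refine h.trans ?_
    have hexp : Real.exp (-(κ₁ * supNorm x)) ≤ Real.exp (-(min κ₁ κ₂ * supNorm x)) :=
      Real.exp_le_exp.mpr (by nlinarith [min_le_left κ₁ κ₂, supNorm_nonneg x])
    exact mul_le_mul (le_max_left _ _) hexp (Real.exp_pos _).le (le_trans hM (le_max_left _ _))
  · intro j x
    haveI hLj : NeZero (L ^ j) := ⟨pow_ne_zero j (NeZero.ne L)⟩
    set n := L ^ j with hn
    have eK : @KunitH d (L ^ (j + 1)) ⟨pow_ne_zero (j + 1) (NeZero.ne L)⟩ x = KunitH (n * L) x := rfl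
    have eK0 : @KunitH d (L ^ j) ⟨pow_ne_zero j (NeZero.ne L)⟩ x = KunitH n x := rfl
    rw [eK, eK0]
    obtain ⟨hE, hF⟩ := h2 n
    obtain ⟨hE', hF'⟩ := h2 (n * L)
    have hsub : Strip (d + 1) (min κ₁ κ₂) ⊆ Strip (d + 1) κ₂ := strip_mono (min_le_right _ _)
    have hκ0 : 0 ≤ min κ₁ κ₂ := (lt_min hκ₁ hκ₂).le
    have hκr' : min κ₁ κ₂ ≤ rOf (d + 1) := (min_le_right _ _).trans hκr
    have hEm : ∀ p ∈ Strip (d + 1) (min κ₁ κ₂), c ≤ ‖E n 1 0 p‖ := fun p hp => hE p (hsub hp)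
    have hEm' : ∀ p ∈ Strip (d + 1) (min κ₁ κ₂), c ≤ ‖E (n * L) 1 0 p‖ := fun p hp => hE' p (hsub hp)
    have hFm : ∀ p ∈ Strip (d + 1) (min κ₁ κ₂), cF ≤ ‖E n 1 0 p - DeltaXi n 0 p‖ := fun p hp => hF p (hsub hp)
    have hFm' : ∀ p ∈ Strip (d + 1) (min κ₁ κ₂), cF ≤ ‖E (n * L) 1 0 p - DeltaXi (n * L) 0 p‖ := fun p hp => hF' p (hsub hp)
    rw [KunitH_sub_eq n L hκ0 hκr' hc hcF hEm hEm' hFm hFm' x]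
    have hreg := stripRegular_meanD n L hκ0 hκr' hc hcF hEm hEm' hFm hFm'
    refine (latticeKernel_decay hreg hκ0 x).trans ?_
    have hnn : CU (d + 1) L c cF / ((n : ℕ) : ℝ) ^ 2 = C₂ * (((L : ℝ) ^ 2)⁻¹) ^ j := by
      rw [hC₂, hn, div_eq_mul_inv]; push_cast; rw [← pow_mul, inv_pow, ← pow_mul, Nat.mul_comm]
    rw [hnn]
    have hexp : 0 ≤ Real.exp (-(min κ₁ κ₂ * supNorm x)) := (Real.exp_pos _).le
    have hLp : 0 ≤ (((L : ℝ) ^ 2)⁻¹) ^ j := by positivity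
    gcongr
    exact le_max_right _ _

end Summit.QuantumFields.BalabanUV.Beta.GAN24.SubAveragingMinimiserUnitTower
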